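import Summits.Ventures.CertifiedManyBodySolver.Theorems.TcThermcert1FreeGasDefs
import Literature.Geometry.Riemannian.TwoConvexSchoenfliesProofs
import HarnessLib

/-!
# Free-gas (`U = 0`) sector witness for TcThermcert1's K1 family — part 5: elementary symmetric functions — log-concavity and the mode fugacity (Darroch bypass)

For positive weights the elementary symmetric functions `e_j` are log-concave in the two-index form `e_{i−1} e_{j+1} ≤ e_i e_j`
(`1 ≤ i ≤ j`, induction on the number of weights), hence EVERY degree `M ≤ n` is the mode of `j ↦ e_j t^j` for some fugacity `t > 0`
(`Inputs.esymm_exists_modeFugacity`), which gives the polynomial floor `(n+1) · e_M t^M ≥ ∏ (1 + t xᵢ)` WITHOUT Darroch's integer-mean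
theorem, Newton's inequalities or the IVT; `Fintype` form `Inputs.esymmModeFugacity_holds : EsymmModeFugacity`.
HONEST FRAMING: statements about the FREE (`U = 0`) twisted torus gas and about symmetric functions of explicit reals;
nothing here touches `U = 8`; superconductivity in the Hubbard model is NOT proved (or disproved) by any of this.
Provenance: landed form of the crux workfile `Cruxes/ThermalStiffnessCeilingU8b10_le_1o8/FreeGasArcSkeleton.lean` v4.1 (tree 80a90c42bbb7)
+ `FreeGasArcInputs.lean` (d3c3c585d14e), planner `hubbard-floor-idea-rescuer` g5, card `free-gas-arc-darroch` (crit-1 KEEP);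
hubbard-floor support target ST-K1-U0-1, `--supports stmt-Ventures-26381` (TcThermcert1 crux K1). Split into ≤ 400-line modules
`Theorems/TcThermcert1FreeGas*.lean`.
-/

noncomputable section

namespace Summit.Ventures.CertifiedManyBodySolver.Theorems.FreeGasArc.Inputs

open Finset Real MeasureTheory
open Literature.Geometry.Riemannian (esymm_zero_eq_one esymm_card_eq_prod esymm_nonneg_of_forall_nonneg
  esymm_eq_zero_of_card_lt esymm_cons_succ)
open scoped BigOperators

/-! ## §B Elementary symmetric functions of a multiset of reals: recursion, vanishing, mass identity, positivity -/

/-- Positive weights have positive `e_k` for every `k ≤ |X|`. -/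
theorem esymm_pos (X : Multiset ℝ) (hX : ∀ a ∈ X, 0 < a) {k : ℕ} (hk : k ≤ Multiset.card X) :
    0 < X.esymm k := by
  induction X using Multiset.induction generalizing k with
  | empty =>
    simp only [Multiset.card_zero, Nat.le_zero] at hk
    subst hk
    rw [esymm_zero_eq_one]
    exact one_pos
  | cons x X ih =>
    have hx : 0 < x := hX x (Multiset.mem_cons_self x X)
    have hX' : ∀ a ∈ X, 0 < a := fun a ha => hX a (Multiset.mem_cons_of_mem ha)
    rcases k with _ | k
    · rw [esymm_zero_eq_one]
      exact one_pos
    · rw [Multiset.card_cons] at hk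
      rw [esymm_cons_succ]
      have h1 : 0 < X.esymm k := ih hX' (by omega)
      have h2 : 0 ≤ X.esymm (k + 1) := esymm_nonneg_of_forall_nonneg X (fun a ha => (hX' a ha).le) _
      nlinarith [mul_pos hx h1]

/-- **Mass identity** `∑_{j ≤ |X|} e_j(X) t^j = ∏_{a ∈ X} (1 + t·a)` (the grand-canonical partition function of
one free species at fugacity `t`). -/
theorem sum_esymm_mul_pow (X : Multiset ℝ) (t : ℝ) :
    ∑ j ∈ Finset.range (Multiset.card X + 1), X.esymm j * t ^ j = (X.map fun a => 1 + t * a).prod := by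
  induction X using Multiset.induction with
  | empty => simp [esymm_zero_eq_one]
  | cons x X ih =>
    set n := Multiset.card X with hn
    set S : ℝ := ∑ j ∈ Finset.range (n + 1), X.esymm j * t ^ j with hS
    have h0 : X.esymm (n + 1) = 0 := esymm_eq_zero_of_card_lt X (by omega)
    have hS' : ∑ i ∈ Finset.range (n + 1), X.esymm (i + 1) * t ^ (i + 1) + 1 = S := by
      have h := Finset.sum_range_succ' (fun i => X.esymm i * t ^ i) (n + 1)
      rw [Finset.sum_range_succ, h0, zero_mul, add_zero, esymm_zero_eq_one, pow_zero, one_mul] at h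
      rw [hS]
      exact h.symm
    rw [Multiset.card_cons, Multiset.map_cons, Multiset.prod_cons, ← ih, Finset.sum_range_succ']
    rw [esymm_zero_eq_one, pow_zero, one_mul]
    have hterm : ∀ i ∈ Finset.range (n + 1),
        (x ::ₘ X).esymm (i + 1) * t ^ (i + 1) = X.esymm (i + 1) * t ^ (i + 1) + t * x * (X.esymm i * t ^ i) := by
      intro i _
      rw [esymm_cons_succ]
      ring
    rw [Finset.sum_congr rfl hterm, Finset.sum_add_distrib, ← Finset.mul_sum, ← hS]
    linear_combination hS'

/-! ## §C Two-index log-concavity of `e_j` for nonnegative weights -/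

/-! Two-index log-concavity of a real sequence `f` means `f(i−1) f(j+1) ≤ f(i) f(j)` for `1 ≤ i ≤ j`
(for positive sequences this is `f(k)² ≥ f(k−1) f(k+1)`, iterated); it is spelled out in each statement. -/

/-- The Viète step `g(k+1) = f(k+1) + c f(k)` (`c ≥ 0`, `g 0 = f 0`) preserves two-index log-concavity of a
nonnegative sequence. -/
theorem lc2_step {f g : ℕ → ℝ} {c : ℝ} (hf : ∀ k, 0 ≤ f k) (hc : 0 ≤ c)
    (hlc : ∀ i j : ℕ, 1 ≤ i → i ≤ j → f (i - 1) * f (j + 1) ≤ f i * f j)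
    (hg0 : g 0 = f 0) (hg : ∀ k, g (k + 1) = f (k + 1) + c * f k) :
    ∀ i j : ℕ, 1 ≤ i → i ≤ j → g (i - 1) * g (j + 1) ≤ g i * g j := by
  intro i j hi hij
  obtain ⟨j', rfl⟩ : ∃ j', j = j' + 1 := ⟨j - 1, by omega⟩
  rcases Nat.lt_or_ge i 2 with hi1 | hi2
  · -- `i = 1`
    have hi' : i = 1 := by omega
    subst hi'
    have hg1 : g 1 = f 1 + c * f 0 := hg 0
    rw [show (1 : ℕ) - 1 = 0 from rfl, hg0, hg1, hg (j' + 1), hg j']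
    have P1 : f 0 * f (j' + 1 + 1) ≤ f 1 * f (j' + 1) := by
      have h := hlc 1 (j' + 1) le_rfl (by omega)
      simpa using h
    nlinarith [mul_nonneg hc (mul_nonneg (hf 1) (hf j')), mul_nonneg (mul_nonneg hc hc) (mul_nonneg (hf 0) (hf j')),
      mul_nonneg hc (mul_nonneg (hf 0) (hf (j' + 1)))]
  · -- `i = i' + 2`
    obtain ⟨i', rfl⟩ : ∃ i', i = i' + 2 := ⟨i - 2, by omega⟩
    rw [show i' + 2 - 1 = i' + 1 by omega, hg i', hg (j' + 1), hg (i' + 1), hg j']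
    have T1 : f (i' + 1) * f (j' + 1 + 1) ≤ f (i' + 2) * f (j' + 1) := by
      have h := hlc (i' + 2) (j' + 1) (by omega) (by omega)
      simpa using h
    have T3a : f i' * f (j' + 1 + 1) ≤ f (i' + 1) * f (j' + 1) := by
      have h := hlc (i' + 1) (j' + 1) (by omega) (by omega)
      simpa using h
    have T3b : f (i' + 1) * f (j' + 1) ≤ f (i' + 2) * f j' := by
      rcases Nat.lt_or_ge (i' + 1) j' with hlt | hge
      · have h := hlc (i' + 2) j' (by omega) (by omega)
        simpa using h
      · have hj : j' = i' + 1 := by omega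
        subst hj
        simp only [mul_comm, le_refl]
    have T4 : f i' * f (j' + 1) ≤ f (i' + 1) * f j' := by
      have h := hlc (i' + 1) j' (by omega) (by omega)
      simpa using h
    have B : c * (f i' * f (j' + 1 + 1)) ≤ c * (f (i' + 2) * f j') :=
      mul_le_mul_of_nonneg_left (T3a.trans T3b) hc
    have C : c * c * (f i' * f (j' + 1)) ≤ c * c * (f (i' + 1) * f j') :=
      mul_le_mul_of_nonneg_left T4 (mul_nonneg hc hc)
    nlinarith [T1, B, C]

/-- **`e_j` of nonnegative weights is two-index log-concave** (induction on the number of weights via the Viète step;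
no Newton inequalities needed). -/
theorem esymm_lc2 (X : Multiset ℝ) (hX : ∀ a ∈ X, 0 ≤ a) :
    ∀ i j : ℕ, 1 ≤ i → i ≤ j → X.esymm (i - 1) * X.esymm (j + 1) ≤ X.esymm i * X.esymm j := by
  induction X using Multiset.induction with
  | empty =>
    intro i j _ _
    have h1 : (0 : Multiset ℝ).esymm (j + 1) = 0 := esymm_eq_zero_of_card_lt 0 (by simp)
    simp only [h1, mul_zero]
    exact mul_nonneg (esymm_nonneg_of_forall_nonneg 0 (by simp) _) (esymm_nonneg_of_forall_nonneg 0 (by simp) _)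
  | cons x X ih =>
    have hx : 0 ≤ x := hX x (Multiset.mem_cons_self x X)
    have hX' : ∀ a ∈ X, 0 ≤ a := fun a ha => hX a (Multiset.mem_cons_of_mem ha)
    exact lc2_step (f := fun k => X.esymm k) (g := fun k => (x ::ₘ X).esymm k) (fun k => esymm_nonneg_of_forall_nonneg X hX' k) hx
      (ih hX') (by simp only [esymm_zero_eq_one]) (fun k => esymm_cons_succ x X k)

/-! ## §D The mode fugacity (Darroch bypass) and the polynomial floor -/

/-- A nonnegative sequence whose ratios cross `1/t` at `M` (`f j ≤ t f(j+1)` below `M`, `t f(j+1) ≤ f j` from `M` on)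
has `j ↦ f(j) t^j` maximal at `M`. -/
theorem mode_of_ratio {f : ℕ → ℝ} {t : ℝ} {M : ℕ} (ht : 0 < t)
    (hdown : ∀ j, j < M → f j ≤ t * f (j + 1)) (hup : ∀ j, M ≤ j → t * f (j + 1) ≤ f j) :
    ∀ j, f j * t ^ j ≤ f M * t ^ M := by
  have up : ∀ d, f (M + d) * t ^ (M + d) ≤ f M * t ^ M := by
    intro d
    induction d with
    | zero => simp
    | succ d ih =>
      have h := hup (M + d) (by omega)
      calc f (M + (d + 1)) * t ^ (M + (d + 1)) = (t * f (M + d + 1)) * t ^ (M + d) := by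
            rw [show M + (d + 1) = M + d + 1 by omega, pow_succ]; ring
        _ ≤ f (M + d) * t ^ (M + d) := mul_le_mul_of_nonneg_right h (pow_nonneg ht.le _)
        _ ≤ _ := ih
  have down : ∀ d, d ≤ M → f (M - d) * t ^ (M - d) ≤ f M * t ^ M := by
    intro d
    induction d with
    | zero => intro _; simp
    | succ d ih =>
      intro hd
      have h := hdown (M - (d + 1)) (by omega)
      rw [show M - (d + 1) + 1 = M - d by omega] at h
      calc f (M - (d + 1)) * t ^ (M - (d + 1)) ≤ (t * f (M - d)) * t ^ (M - (d + 1)) :=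
            mul_le_mul_of_nonneg_right h (pow_nonneg ht.le _)
        _ = f (M - d) * t ^ (M - d) := by
            rw [show M - d = M - (d + 1) + 1 by omega, pow_succ]; ring
        _ ≤ _ := ih (by omega)
  intro j
  rcases Nat.lt_or_ge j M with h | h
  · have h' := down (M - j) (by omega)
    rwa [show M - (M - j) = j by omega] at h'
  · obtain ⟨d, rfl⟩ : ∃ d, j = M + d := ⟨j - M, by omega⟩
    exact up d

/-- **Mode fugacity (Darroch bypass).** For positive weights and EVERY degree `M ≤ |X|` there is a fugacity `t > 0`
at which `M` is the mode of `j ↦ e_j(X) t^j`.  (Darroch's theorem — integer mean ⇒ mode — is not needed: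
log-concavity alone makes every degree an exposed point of the concave sequence `log e_j`.) -/
theorem esymm_exists_modeFugacity (X : Multiset ℝ) (hX : ∀ a ∈ X, 0 < a) {M : ℕ}
    (hM : M ≤ Multiset.card X) :
    ∃ t : ℝ, 0 < t ∧ ∀ j, X.esymm j * t ^ j ≤ X.esymm M * t ^ M := by
  set n := Multiset.card X with hn
  have hpos : ∀ k, k ≤ n → 0 < X.esymm k := fun k hk => esymm_pos X hX hk
  have hlc := esymm_lc2 X (fun a ha => (hX a ha).le)
  rcases Nat.lt_or_ge M n with hMn | hMn
  · -- `M < n`: `t = e_M / e_{M+1}`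
    have hM1 : 0 < X.esymm (M + 1) := hpos (M + 1) hMn
    refine ⟨X.esymm M / X.esymm (M + 1), div_pos (hpos M hMn.le) hM1, ?_⟩
    apply mode_of_ratio (div_pos (hpos M hMn.le) hM1)
    · intro j hj
      have h := hlc (j + 1) M (by omega) (by omega)
      simp only [Nat.add_sub_cancel] at h
      rw [div_mul_eq_mul_div, le_div_iff₀ hM1]
      linarith [h]
    · intro j hj
      rcases eq_or_lt_of_le hj with rfl | hlt
      · rw [div_mul_cancel₀ _ hM1.ne']
      · have h := hlc (M + 1) j (by omega) (by omega)
        simp only [Nat.add_sub_cancel] at h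
        rw [div_mul_eq_mul_div, div_le_iff₀ hM1]
        linarith [h]
  · have hMeq : M = n := le_antisymm hM hMn
    rcases Nat.eq_zero_or_pos n with hn0 | hnpos
    · refine ⟨1, one_pos, fun j => ?_⟩
      rcases Nat.eq_zero_or_pos j with rfl | hj
      · rw [hMeq, hn0]
      · rw [esymm_eq_zero_of_card_lt X (show Multiset.card X < j by omega), zero_mul]
        exact mul_nonneg (hpos M hM).le (pow_nonneg zero_le_one _)
    · -- `M = n ≥ 1`: `t = e_{n-1} / e_n`
      have hnn : 0 < X.esymm n := hpos n le_rfl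
      refine ⟨X.esymm (n - 1) / X.esymm n, div_pos (hpos _ (by omega)) hnn, ?_⟩
      rw [hMeq]
      apply mode_of_ratio (div_pos (hpos _ (by omega)) hnn)
      · intro j hj
        rcases Nat.lt_or_ge (j + 1) n with hlt | hge
        · have h := hlc (j + 1) (n - 1) (by omega) (by omega)
          rw [Nat.add_sub_cancel, show n - 1 + 1 = n by omega] at h
          rw [div_mul_eq_mul_div, le_div_iff₀ hnn]
          linarith [h]
        · have hj' : j = n - 1 := by omega
          subst hj'
          rw [show n - 1 + 1 = n by omega, div_mul_cancel₀ _ hnn.ne']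
      · intro j hj
        rw [esymm_eq_zero_of_card_lt X (show Multiset.card X < j + 1 by omega), mul_zero]
        exact esymm_nonneg_of_forall_nonneg X (fun a ha => (hX a ha).le) j

/-- **Polynomial floor at the mode fugacity:** `∏_{a ∈ X} (1 + t a) ≤ (|X| + 1) · e_M(X) t^M`. -/
theorem prod_one_add_mul_le_of_mode (X : Multiset ℝ) {t : ℝ} {M : ℕ}
    (hmode : ∀ j, X.esymm j * t ^ j ≤ X.esymm M * t ^ M) :
    (X.map fun a => 1 + t * a).prod ≤ ((Multiset.card X : ℝ) + 1) * (X.esymm M * t ^ M) := by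
  rw [← sum_esymm_mul_pow]
  calc ∑ j ∈ Finset.range (Multiset.card X + 1), X.esymm j * t ^ j
      ≤ ∑ _j ∈ Finset.range (Multiset.card X + 1), X.esymm M * t ^ M := Finset.sum_le_sum fun j _ => hmode j
    _ = ((Multiset.card X : ℝ) + 1) * (X.esymm M * t ^ M) := by
      rw [Finset.sum_const, Finset.card_range, nsmul_eq_mul]
      push_cast
      ring

/-- **Mode fugacity, `Fintype` form:** for positive weights `x : ι → ℝ` and every `M ≤ |ι|` there is a real `s`
with `e_j(x) e^{s j} ≤ e_M(x) e^{s M}` for all `j`, and then `∏ᵢ (1 + e^{s} xᵢ) ≤ (|ι| + 1) e_M(x) e^{sM}`. -/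
def EsymmModeFugacity : Prop :=
  ∀ (ι : Type) [Fintype ι] [DecidableEq ι] (x : ι → ℝ) (M : ℕ), (∀ i, 0 < x i) → M ≤ Fintype.card ι →
    ∃ s : ℝ, (∀ j : ℕ, esymmW x j * Real.exp (s * j) ≤ esymmW x M * Real.exp (s * M)) ∧
      (∏ i, (1 + Real.exp s * x i)) ≤ ((Fintype.card ι : ℝ) + 1) * (esymmW x M * Real.exp (s * M))

/-- `EsymmModeFugacity` holds (Darroch bypass: log-concavity makes every degree a mode). -/
theorem esymmModeFugacity_holds : EsymmModeFugacity := by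
  intro ι _ _ x M hx hM
  set X : Multiset ℝ := (Finset.univ : Finset ι).val.map x with hXdef
  have hcard : Multiset.card X = Fintype.card ι := by
    rw [hXdef, Multiset.card_map]
    rfl
  have hXpos : ∀ a ∈ X, 0 < a := by
    intro a ha
    rw [hXdef, Multiset.mem_map] at ha
    obtain ⟨i, _, rfl⟩ := ha
    exact hx i
  obtain ⟨t, ht, hmode⟩ := esymm_exists_modeFugacity X hXpos (M := M) (by rw [hcard]; exact hM)
  refine ⟨Real.log t, ?_, ?_⟩
  · intro j
    have e1 : Real.exp (Real.log t * j) = t ^ j := by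
      rw [mul_comm, Real.exp_nat_mul, Real.exp_log ht]
    have e2 : Real.exp (Real.log t * M) = t ^ M := by
      rw [mul_comm, Real.exp_nat_mul, Real.exp_log ht]
    rw [e1, e2, esymmW_eq_esymm, esymmW_eq_esymm]
    exact hmode j
  · have e2 : Real.exp (Real.log t * M) = t ^ M := by
      rw [mul_comm, Real.exp_nat_mul, Real.exp_log ht]
    rw [e2, Real.exp_log ht, esymmW_eq_esymm, ← hcard]
    have hprod : (∏ i, (1 + t * x i)) = (X.map fun a => 1 + t * a).prod := by
      rw [hXdef, Multiset.map_map, Function.comp_def]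
      exact (Finset.prod_map_val Finset.univ (fun i => 1 + t * x i)).symm
    rw [hprod]
    exact prod_one_add_mul_le_of_mode X hmode

end Summit.Ventures.CertifiedManyBodySolver.Theorems.FreeGasArc.Inputs

end
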